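import Mathlib
import HarnessLib
import Literature.Analysis.FluidPDE.FluidComputer.EnergyParseval
import Literature.Analysis.FluidPDE.FluidComputer.ClassicalLatticeSpectra
import Summits.NavierStokesRegularity.FluidComputer.BandSupCeiling

/-!
# Band sup ceiling — the reality hypothesis discharged, and the Taylor–Green instance `u² + v² + w² ≤ 4/3`

HONEST FRAMING (cell `pub-fluidc`, verbatim): *low prior, high value-of-information experiment on
Tao's machine paradigm; NOT a claim that NS blows up.* Companion of `BandSupCeiling` (pub-fluidc-lit
gen 46). Nothing about the Navier–Stokes evolution.
* `neg_mem_of_flipAt` — a band closed under the three coordinate sign changes is closed under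
  `k ↦ -k` (the composite of the three flips);
* `field_re_normSq_le` — the headline ceiling **`Σ_j (Re u_{B,j}(x))² ≤ (4/3)·#B·E_B`** for every
  `FourierVelocity` and every band `B ∌ 0` closed under coordinate sign changes and exchanges, with NO
  pointwise hypothesis: the reality of the physical field is the tree's
  `ShellTransfer.field_im_eq_zero` (EnergyParseval) on the `-k`-closed band;
* `taylorGreen_normSq_le` — NON-VACUITY / SANITY INSTANCE on the tree's Taylor–Green datum
  (`TaylorGreenHat.tg` on its 8 modes `(±1,±1,±1)`, `E = 1/8` by `truncEnergy_tg`):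
  `u² + v² + w² ≤ (4/3)·8·(1/8) = 4/3` at every point, for the closed forms
  `u = sin x cos y cos z`, `v = -cos x sin y cos z`, `w = 0` (true sup `1`; the ceiling is not sharp on
  TG, whose 8 modes are not phase-aligned at one point, coherence `φ = √(3/4) ≈ 0.87`).
Theorems only (no definitions, no named facts, D-0026).
-/

noncomputable section

namespace Summit.NavierStokesRegularity.FluidComputer.BandSupCeiling

open Complex Finset Real
open Literature.Analysis.FluidPDE Literature.Analysis.FluidPDE.FluidComputer
open Literature.Analysis.FluidPDE.FluidComputer.ShellTransfer
open scoped BigOperators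

variable (U : FourierVelocity)

/-- `-k` is the composite of the three coordinate sign changes. -/
theorem flipAt_three (k : Fin 3 → ℤ) : flipAt 0 (flipAt 1 (flipAt 2 k)) = -k := by
  funext l
  fin_cases l <;> simp [flipAt]

/-- A band closed under the coordinate sign changes is closed under `k ↦ -k`. -/
theorem neg_mem_of_flipAt {B : Finset (Fin 3 → ℤ)} (hflip : ∀ i, ∀ k ∈ B, flipAt i k ∈ B)
    {k : Fin 3 → ℤ} (hk : k ∈ B) : -k ∈ B := by
  rw [← flipAt_three]
  exact hflip 0 _ (hflip 1 _ (hflip 2 _ hk))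

/-- **Band sup ceiling, hypothesis-free form**: for every real incompressible coefficient field and
every band `B ∌ 0` closed under coordinate sign changes and exchanges (every lattice shell
`{a ≤ |k| < b}`), at every point `Σ_j (Re u_{B,j}(x))² ≤ (4/3)·#B·E_B`; the field IS real there
(`field_im_eq_zero`), so this is `|u_B(x)|² ≤ (4/3)·#B·E_B`. -/
theorem field_re_normSq_le (B : Finset (Fin 3 → ℤ)) (hB : ∀ k ∈ B, k ≠ 0)
    (hflip : ∀ i, ∀ k ∈ B, flipAt i k ∈ B) (hswap : ∀ i j, ∀ k ∈ B, swapAt i j k ∈ B)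
    (x y z : ℝ) :
    ∑ j, (field U B j x y z).re ^ 2 ≤ 4 / 3 * (B.card : ℝ) * truncEnergy U B :=
  field_real_normSq_le U B hB hflip hswap x y z
    (fun j => field_im_eq_zero U B (fun _ hk => neg_mem_of_flipAt hflip hk) j x y z)

/-! ## The Taylor–Green instance -/

namespace TaylorGreenInstance

open TaylorGreenHat

/-- The TG modes `(±1,±1,±1)` avoid the zero mode. -/
theorem modes_ne_zero : ∀ k ∈ TaylorGreenHat.modes, k ≠ 0 := by
  intro k hk h0
  have h := (mem_modes.mp hk).1
  rw [h0, Pi.zero_apply, mem_pmOne] at h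
  rcases h with h | h <;> norm_num at h

/-- The TG mode set is closed under coordinate sign changes. -/
theorem modes_flipAt (i : Fin 3) : ∀ k ∈ TaylorGreenHat.modes, flipAt i k ∈ TaylorGreenHat.modes := by
  intro k hk
  obtain ⟨h0, h1, h2⟩ := mem_modes.mp hk
  rw [mem_modes]
  fin_cases i
  · exact ⟨by simpa [flipAt] using neg_mem_pmOne h0, by simpa [flipAt] using h1, by simpa [flipAt] using h2⟩
  · exact ⟨by simpa [flipAt] using h0, by simpa [flipAt] using neg_mem_pmOne h1, by simpa [flipAt] using h2⟩
  · exact ⟨by simpa [flipAt] using h0, by simpa [flipAt] using h1, by simpa [flipAt] using neg_mem_pmOne h2⟩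

/-- The TG mode set is closed under coordinate exchanges. -/
theorem modes_swapAt (i j : Fin 3) : ∀ k ∈ TaylorGreenHat.modes, swapAt i j k ∈ TaylorGreenHat.modes := by
  intro k hk
  obtain ⟨h0, h1, h2⟩ := mem_modes.mp hk
  have hall : ∀ l : Fin 3, k l ∈ pmOne := by
    intro l; fin_cases l <;> assumption
  rw [mem_modes]
  exact ⟨hall _, hall _, hall _⟩

/-- `#modes = 8`. -/
theorem card_modes : TaylorGreenHat.modes.card = 8 := by
  unfold TaylorGreenHat.modes
  rw [Finset.card_image_of_injective _ vec3_injective]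
  rfl

/-- **Taylor–Green instance of the band sup ceiling**: `u² + v² + w² ≤ 4/3` pointwise for
`u = sin x cos y cos z`, `v = -cos x sin y cos z`, `w = 0` — `(4/3)·#B·E_B` with `#B = 8`,
`E_B = 1/8`. (The true maximum is `1`: TG's coherence is `√(3/4)`.) -/
theorem taylorGreen_normSq_le (x y z : ℝ) :
    TaylorGreen.u x y z ^ 2 + TaylorGreen.v x y z ^ 2 + TaylorGreen.w x y z ^ 2 ≤ 4 / 3 := by
  have h := field_re_normSq_le tg TaylorGreenHat.modes modes_ne_zero modes_flipAt modes_swapAt x y z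
  rw [Fin.sum_univ_three, field_eq_u, field_eq_v, field_eq_w, Complex.ofReal_re, Complex.ofReal_re,
    Complex.ofReal_re, card_modes, truncEnergy_tg] at h
  norm_num at h
  exact h

end TaylorGreenInstance

end Summit.NavierStokesRegularity.FluidComputer.BandSupCeiling

end
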